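import Summits.QuantumFields.YangMills.Theorems.ColdStartUniversalityLindebergSwapFreeStubs
import Summits.QuantumFields.BalabanUV.T4Continuum.Support.SubstrateBlockAvgContinuity
import Literature.MathematicalPhysics.QuantumFieldTheory.Balaban1983to89.T3LevelShift
import HarnessLib

/-!
# Crux `ColdStartContinuumCauchy` (stmt-QuantumFields-24810, route `ColdStartUniversality`), LINE 3 «lindeberg_swap» (planner ym-idea-5 g5/g15):
# stub `stub_stepDownCompat` — SCHEME-TRANSPORT COMPATIBILITY OF BAŁABAN'S ITERATED AVERAGES

The registered stub `StepDownCompat` of the «lindeberg_swap» skeleton (sha 5aa38edd…; defs `toField`, `obsK`, `siteDown`, `stepDown`,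
`__Registered.stub_stepDownCompat` are the tree's since p665853, `…ColdStartUniversalityLindebergSwapFreeStubs`):
for every family `F` and every `K`, (i) every step-`(K+1)` unit loop string `obsK (K+1) os c` equals the step-`K` unit loop string
`obsK K os (stepDown c)` of the one-step Bałaban average `stepDown c` (read as a configuration of the coarser approximation through the
`ZMod` site identification), and (ii) `stepDown 1 = 1`.

The memo LANDABLE-NOW-g15 §4.1 (planner ym-idea-5 g15) budgeted 400–700 lines of primitive-by-primitive commutation; the tree already HAS the
two-tower identification kit `Literature.…Balaban1983to89.T3LevelShift` (fleet seat, [Balaban1987RG1] (0.1)/(0.4)/(0.11)): `siteShift`/`bondShift`/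
`fieldShift` along equal moduli, `blockAvg_fieldShift`, `iterFrom_fieldShift`, `fieldShift_fieldShift`, `unitShift` and
`T3Family.avgObs_eq_loopAt_unitShift`, so the proof is bookkeeping over that kit:
* `siteDown_eq_siteShift`: the skeleton's `siteDown` IS `siteShift` along `(F.PP F.m K).sitesPerDir 0 = (F.PP F.m (K+1)).sitesPerDir 1`
  (`ZMod.ringEquivCongr_symm` + proof irrelevance), hence `toField (stepDown c) = fieldShift _ (avg (toField c))` (`toField_stepDown`);
* `unitShift_iter_fieldShift`: `K` averagings on the coarser tower of that shifted one-step average, read on the unit lattice, are the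
  `(K+1)`-fold average on the finer tower read on the unit lattice (`iterFrom_fieldShift` with `k₀ = 1`, `T4AvgSensitivity.iter_add`,
  `fieldShift_fieldShift`, and `1 + K = K + 1` by `subst`);
* `avgObs_stepDown` / `obsK_stepDown`: (i) loop by loop via `avgObs_eq_loopAt_unitShift`; `stepDown_one`: (ii) from
  `SubstrateBlockAvgContinuity.blockAvg_expMeanLogSU_one` (the `SU(2)` average of record fixes the unit configuration).

Width seat ym-line-sfw-p2-w5 g11 (cell ym-idea-1; free hands), planner-of-record ym-idea-5 g15 (free-hands order (v), critic idea-crit-5 NOTE #165),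
`--supports stmt-QuantumFields-24810`.  THEOREMS ONLY.  HONEST FRAMING: [folklore] lattice bookkeeping; LINE 3's content is `stub_oneWindowSwap` /
`stub_scalePropagation` (XL, OPEN) and `stub_lindebergTelescoping` / `stub_shortWindowSwap`; no crux, rung (CSU is a RECORD-rung ladder) or summit
is proved; the Yang–Mills mass gap is NOT proved.
-/

set_option autoImplicit false

noncomputable section

namespace Summit.QuantumFields.YangMills.Cruxes.ColdStartContinuumCauchy.LindebergSwap

open Literature.MathematicalPhysics.QuantumFieldTheory
open Literature.MathematicalPhysics.QuantumFieldTheory.Balaban1983to89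
open Literature.MathematicalPhysics.QuantumFieldTheory.Balaban1983to89.T3ContinuumYM3Torus
open Literature.MathematicalPhysics.QuantumFieldTheory.Balaban1983to89.T3LevelShift
open Literature.MathematicalPhysics.QuantumLattice

namespace StepDown

variable (F : T3Family)

/-- Level `0` of the `K`-th approximation and level `1` of the `(K+1)`-th have the same modulus `2·L^{m+K}` (as an instance of
`T3Family.sitesPerDir_eq`). [cite: Balaban1987RG1, (0.1) p.251] -/
theorem sitesPerDir_zero_eq_succ_one (K : ℕ) : (F.PP F.m K).sitesPerDir 0 = (F.PP F.m (K + 1)).sitesPerDir 1 :=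
  F.sitesPerDir_eq (by omega)

/-- The skeleton's site identification `siteDown` IS the tree's `T3LevelShift.siteShift` along that modulus equality
(`ZMod.ringEquivCongr_symm`). [cite: Balaban1987RG1, (0.1) p.251] -/
theorem siteDown_eq_siteShift (K : ℕ) (x : Fin 3 → ZMod ((F.P K).sitesPerDir 0)) :
    siteDown F K x = siteShift (sitesPerDir_zero_eq_succ_one F K) x := by
  funext ν
  show (ZMod.ringEquivCongr _).symm (x ν) = coordEquiv (sitesPerDir_zero_eq_succ_one F K) (x ν)
  rw [ZMod.ringEquivCongr_symm]
  rfl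

/-- **`toField ∘ stepDown = fieldShift ∘ avg ∘ toField`**: the swap map of the Lindeberg scheme is ONE Bałaban (0.4)-averaging on the finer
tower followed by the level identification of `T3LevelShift`. [cite: Balaban1987RG1, (0.4) p.253] -/
theorem toField_stepDown (K : ℕ) (c : GaugeConfig 3 ((F.P (K + 1)).sitesPerDir 0) G2) :
    toField F K (stepDown F K c) =
      fieldShift (sitesPerDir_zero_eq_succ_one F K)
        ((BlockAveraging.blockAvg (P := F.P (K + 1)) (j := 0) avSU).avg (toField F (K + 1) c)) := by
  funext b
  show (BlockAveraging.blockAvg (P := F.P (K + 1)) (j := 0) avSU).avg (toField F (K + 1) c) ⟨siteDown F K b.src, b.dir⟩ =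
    (BlockAveraging.blockAvg (P := F.P (K + 1)) (j := 0) avSU).avg (toField F (K + 1) c)
      (bondShift (sitesPerDir_zero_eq_succ_one F K) b)
  rw [siteDown_eq_siteShift]
  rfl

/-- Reading an iterate on the unit lattice does not depend on how the level index is written (`1 + K` vs `K + 1`). [folklore] -/
theorem fieldShift_iter_congr (K : ℕ) {a b : ℕ} (hab : a = b)
    (p : (F.PP F.m 0).sitesPerDir 0 = (F.PP F.m (K + 1)).sitesPerDir a)
    (q : (F.PP F.m 0).sitesPerDir 0 = (F.PP F.m (K + 1)).sitesPerDir b) (V : GaugeField (F.P (K + 1)) 0 G2) :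
    fieldShift p (Averaging.iter (fun i => BlockAveraging.blockAvg (P := F.P (K + 1)) (j := i) avSU) a V) =
      fieldShift q (Averaging.iter (fun i => BlockAveraging.blockAvg (P := F.P (K + 1)) (j := i) avSU) b V) := by
  subst hab
  rfl

/-- **`K` averagings on the coarser tower of the shifted one-step average = the `(K+1)`-fold average on the finer tower, both read on
the unit lattice** (`T3LevelShift.iterFrom_fieldShift` with `k₀ = 1`, `T4AvgSensitivity.iter_add`, `fieldShift_fieldShift`). [cite: Balaban1987RG1, (0.11) p.253] -/
theorem unitShift_iter_fieldShift (K : ℕ) (V : GaugeField (F.P (K + 1)) 0 G2) :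
    unitShift F K (Averaging.iter (fun i => BlockAveraging.blockAvg (P := F.P K) (j := i) avSU) K
        (fieldShift (sitesPerDir_zero_eq_succ_one F K) ((BlockAveraging.blockAvg (P := F.P (K + 1)) (j := 0) avSU).avg V))) =
      unitShift F (K + 1) (Averaging.iter (fun i => BlockAveraging.blockAvg (P := F.P (K + 1)) (j := i) avSU) (K + 1) V) := by
  have hK : (F.PP F.m K).sitesPerDir K = (F.PP F.m (K + 1)).sitesPerDir (1 + K) := F.sitesPerDir_eq (by omega)
  have h1 := iterFrom_fieldShift (F := F) (m := F.m) (K := K + 1) (m₂ := F.m) (K₂ := K) (k₀ := 1) avSU (by omega) K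
    ((BlockAveraging.blockAvg (P := F.P (K + 1)) (j := 0) avSU).avg V)
  have hA : Averaging.iter (fun i => BlockAveraging.blockAvg (P := F.P K) (j := i) avSU) K
        (fieldShift (sitesPerDir_zero_eq_succ_one F K) ((BlockAveraging.blockAvg (P := F.P (K + 1)) (j := 0) avSU).avg V)) =
      fieldShift hK (T4AvgSensitivity.iterFrom (fun i => BlockAveraging.blockAvg (P := F.P (K + 1)) (j := i) avSU) 1 K
        ((BlockAveraging.blockAvg (P := F.P (K + 1)) (j := 0) avSU).avg V)) := h1.symm
  refine (congrArg (unitShift F K) hA).trans ?_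
  refine (fieldShift_fieldShift (F.sitesPerDir_unit K) hK _).trans ?_
  refine (congrArg (fieldShift ((F.sitesPerDir_unit K).trans hK))
    (T4AvgSensitivity.iter_add (fun i => BlockAveraging.blockAvg (P := F.P (K + 1)) (j := i) avSU) 1 K V).symm).trans ?_
  exact fieldShift_iter_congr F K (Nat.add_comm 1 K) _ _ V

/-- **ONE LOOP**: the step-`(K+1)` unit observable of a configuration is the step-`K` unit observable of its one-step average
(`T3Family.avgObs_eq_loopAt_unitShift` on both sides). [cite: Balaban1987RG1, (0.2)/(0.4) p.252] -/
theorem avgObs_stepDown (K : ℕ) (C : ULoop3 F) (c : GaugeConfig 3 ((F.P (K + 1)).sitesPerDir 0) G2) :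
    F.avgObs avSU (K + 1) C (toField F (K + 1) c) = F.avgObs avSU K C (toField F K (stepDown F K c)) := by
  rw [T3Family.avgObs_eq_loopAt_unitShift, T3Family.avgObs_eq_loopAt_unitShift, toField_stepDown,
    unitShift_iter_fieldShift]

/-- **LOOP STRINGS**: `obsK (K+1) os c = obsK K os (stepDown c)`. [cite: Balaban1987RG1, (0.2)/(0.4) p.252] -/
theorem obsK_stepDown (K : ℕ) (os : List (ULoop3 F)) (c : GaugeConfig 3 ((F.P (K + 1)).sitesPerDir 0) G2) :
    obsK F (K + 1) os c = obsK F K os (stepDown F K c) := by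
  unfold obsK
  congr 1
  refine List.map_congr_left fun C _ => ?_
  exact avgObs_stepDown F K C c

/-- **THE COLD CONFIGURATION AVERAGES TO THE COLD CONFIGURATION**: `stepDown 1 = 1` (the `SU(2)` average of record fixes `1`,
`SubstrateBlockAvgContinuity.blockAvg_expMeanLogSU_one`). [cite: Balaban1987RG1, (0.4) p.253] -/
theorem stepDown_one (K : ℕ) : stepDown F K (fun _ => 1) = fun _ => 1 := by
  funext e
  have h1 : (toField F (K + 1) fun _ => (1 : G2)) = 1 := rfl
  show (BlockAveraging.blockAvg (P := F.P (K + 1)) (j := 0) avSU).avg (toField F (K + 1) fun _ => 1) _ = 1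
  rw [h1, Summit.QuantumFields.BalabanUV.T4Continuum.SubstrateBlockAvgContinuity.blockAvg_expMeanLogSU_one]
  rfl

end StepDown

/-! ## The stub, registered name and statement -/

/-- **Stub `stub_stepDownCompat` of LINE 3 «lindeberg_swap» (crux stmt-QuantumFields-24810), registered statement `StepDownCompat`**:
for every family and every `K`, every step-`(K+1)` unit loop string equals the step-`K` unit loop string of the one-step average, and
`stepDown 1 = 1`. [cite: Balaban1987RG1, (0.4)/(0.11) p.253] -/
theorem stub_stepDownCompat : __Registered.stub_stepDownCompat :=
  fun F K => ⟨fun os c => StepDown.obsK_stepDown F K os c, StepDown.stepDown_one F K⟩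

end Summit.QuantumFields.YangMills.Cruxes.ColdStartContinuumCauchy.LindebergSwap
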